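import Mathlib
import Literature.NumberTheory.LFunctions.Zhang2022.SkeletonPartThree
import Literature.NumberTheory.LFunctions.Zhang2022.Section14MeanSquareMajorant
import HarnessLib

/-!
# Zhang (2022), §15 (15.1)–(15.2): the coefficients `b(n)` of `B(s,ψ)` — kernel-checked

Topic `Literature/NumberTheory/LFunctions/Zhang2022` (Landau–Siegel audit tree; verdict-neutral).
Y. Zhang, *Discrete mean estimates and the Landau–Siegel zero*, arXiv:2211.02515v1 (2022)
[Zhang2022LandauSiegel] — an unrefereed manuscript under adjudication; nothing here bears on its
Theorems 1–2. DAG nodes `Z22:(15.1)`, `Z22:(15.2)` [Z22 p.79, (15.1)–(15.2), tex L3980–3983]: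

* **(15.1)** "In view of (12.2), `B(s,ψ)` can be written as `B(s,ψ) = Σ_n b(n)χψ(n)n^{−s}`":
  `Bpoly_eq_tsum_bcoef` — the banked `Skeleton.Bpoly` (12.2) `= (H₁₄ + ι₂H₁₂)(ῑ₃H₁₃ + ῑ₄H₁₂)` IS the
  Dirichlet series with the banked coefficients `Skeleton.bcoef` (the `ϰ`-convolution) against
  `ψχ(n)n^{−s}`, for every `D`, `ψ ∈ Ψ`, `s` (exact identity: product of two finitely supported
  Dirichlet series, Mathlib's `LSeries_convolution'`, `ψχ` completely multiplicative); finite form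
  `Bpoly_eq_sum_bcoef`;
* **(15.2)** "`b(n) ≪ τ₂(n)`, `b(n) = 0` if `n > PT⁻²η₊`": `norm_bcoef_le` (constant
  `(1+|ι₂|)(|ι₃|+|ι₄|)`, from `|ϰⱼ| ≤ 1` and the tree's `MeanSquareMajorant.norm_seqConv_le_tau_two`)
  and `bcoef_eq_zero_of_le` (already `b(n) = 0` for `n ≥ PT⁻²`, `𝓛 ≥ 3`: the support of `b` is
  `n < P^{1/2}·max(P₂,P₃) ≤ max(PT⁻¹⁰, P^{0.998})`), packaged as `eq15_2_statement` in the exact shape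
  L4-t1 typed (`Typed.Section15A.Eq15_2`, p412590 — bridged by `exact` once that file lands).

The two factors' coefficient sequences are written out in place: `u(n) = ϰ₁(n)·[n < P^{1/2}] + ι₂ϰ₂(n)`
and `v(n) = ῑ₃ϰ₃(n) + ῑ₄ϰ₂(n)` (so that `b = u ⋆ v` is the banked `bcoef` definitionally).

## References

* Y. Zhang, arXiv:2211.02515v1 (2022), §15 (15.1)–(15.2) p. 79; §12 (12.2); §8 (8.6); §2 (2.21),
  (2.26)–(2.27). [cite: Zhang2022LandauSiegel, §15 (15.1)–(15.2)]
-/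

noncomputable section

open Complex Real ComplexConjugate
open scoped LSeries.notation

namespace Literature.NumberTheory.LFunctions.Zhang2022.Skeleton

section Coefficients

variable {D : ℕ} (χ : DirichletCharacter ℂ D) (x : Chr D)

/-- `b = u ⋆ v` as the tree's `MeanSquareMajorant.seqConv` (the banked `bcoef` is literally this
Dirichlet convolution). [cite: Zhang2022LandauSiegel, §15 (15.1)] -/
private theorem bcoef_eq_seqConv (n : ℕ) :
    bcoef D n = MeanSquareMajorant.seqConv
      (fun a : ℕ => (if (a : ℝ) < bigP D ^ (1 / 2 : ℝ) then vk1 D a else 0) + iota2 * vk2 D a)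
      (fun a : ℕ => conj iota3 * vk3 D a + conj iota4 * vk2 D a) n := by
  rw [bcoef, MeanSquareMajorant.seqConv]

/-- `b = u ⋆ v` as Mathlib's `LSeries.convolution`. [cite: Zhang2022LandauSiegel, §15 (15.1)] -/
private theorem bcoef_eq_convolution (n : ℕ) :
    bcoef D n =
      ((fun a : ℕ => (if (a : ℝ) < bigP D ^ (1 / 2 : ℝ) then vk1 D a else 0) + iota2 * vk2 D a) ⍟
        (fun a : ℕ => conj iota3 * vk3 D a + conj iota4 * vk2 D a)) n := by
  rw [bcoef, LSeries.convolution_def]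

/-! ### (15.2): `b(n) ≪ τ₂(n)` -/

/-- `|u(n)| ≤ 1 + |ι₂|` (for `𝓛 ≥ 2`). [cite: Zhang2022LandauSiegel, §15 (15.2)] -/
private theorem norm_ucoef_le (hD : 2 ≤ Real.log D) (n : ℕ) :
    ‖(if (n : ℝ) < bigP D ^ (1 / 2 : ℝ) then vk1 D n else 0) + iota2 * vk2 D n‖ ≤ 1 + ‖iota2‖ := by
  refine (norm_add_le _ _).trans (add_le_add ?_ ?_)
  · split_ifs
    · exact norm_vk1_le hD n
    · simp
  · rw [norm_mul]
    exact mul_le_of_le_one_right (norm_nonneg _) (norm_vk2_le hD n)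

/-- `|v(n)| ≤ |ι₃| + |ι₄|` (for `𝓛 ≥ 2`). [cite: Zhang2022LandauSiegel, §15 (15.2)] -/
private theorem norm_vcoef_le (hD : 2 ≤ Real.log D) (n : ℕ) :
    ‖conj iota3 * vk3 D n + conj iota4 * vk2 D n‖ ≤ ‖iota3‖ + ‖iota4‖ := by
  refine (norm_add_le _ _).trans (add_le_add ?_ ?_)
  · rw [norm_mul, Complex.norm_conj]
    exact mul_le_of_le_one_right (norm_nonneg _) (norm_vk3_le hD n)
  · rw [norm_mul, Complex.norm_conj]
    exact mul_le_of_le_one_right (norm_nonneg _) (norm_vk2_le hD n)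

/-- **(15.2), first assertion: `b(n) ≪ τ₂(n)`** with the explicit constant `(1+|ι₂|)(|ι₃|+|ι₄|)`
(for `𝓛 = log D ≥ 2`). [cite: Zhang2022LandauSiegel, §15 (15.2) p. 79] -/
theorem norm_bcoef_le (hD : 2 ≤ Real.log D) (n : ℕ) :
    ‖bcoef D n‖ ≤ (1 + ‖iota2‖) * (‖iota3‖ + ‖iota4‖) * MeanSquareMajorant.tau 2 n := by
  rw [bcoef_eq_seqConv]
  exact MeanSquareMajorant.norm_seqConv_le_tau_two (by positivity)
    (fun m _ => norm_ucoef_le hD m) (fun m _ => norm_vcoef_le hD m) n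

/-! ### (15.2): the support of `b` -/

/-- `P^{1/2} ≤ P₁ = P^{0.504}`. [cite: Zhang2022LandauSiegel, §2 (2.21)] -/
private theorem sqrtP_le_P1 : bigP D ^ (1 / 2 : ℝ) ≤ P1 D := by
  rw [P1]
  exact Real.rpow_le_rpow_of_exponent_le
    (Real.one_le_exp (pow_nonneg (Real.log_natCast_nonneg D) _)) (by norm_num)

/-- `P₂ ≤ P^{1/2}` (`P₂ = P^{1/2}T⁻¹⁰`). [cite: Zhang2022LandauSiegel, §2 (2.21)] -/
private theorem P2_le_sqrtP : P2 D ≤ bigP D ^ (1 / 2 : ℝ) := by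
  have hT : 1 ≤ bigT D ^ 10 :=
    one_le_pow₀ (Real.one_le_exp (Real.rpow_nonneg (Real.log_natCast_nonneg D) _))
  have h0 : 0 ≤ bigP D ^ (1 / 2 : ℝ) := Real.rpow_nonneg (Real.exp_pos _).le _
  rw [P2, show (0.5 : ℝ) = 1 / 2 by norm_num]
  exact div_le_self h0 hT

/-- `u(a) = 0` for `a ≥ P^{1/2}`. [cite: Zhang2022LandauSiegel, §15 (15.2)] -/
private theorem ucoef_eq_zero {a : ℕ} (ha : bigP D ^ (1 / 2 : ℝ) ≤ a) :
    (if (a : ℝ) < bigP D ^ (1 / 2 : ℝ) then vk1 D a else 0) + iota2 * vk2 D a = 0 := by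
  rw [if_neg (not_lt.mpr ha), vk2_eq_zero (le_trans P2_le_sqrtP ha)]
  simp

/-- `v(b) = 0` for `b ≥ max(P₂, P₃)`. [cite: Zhang2022LandauSiegel, §15 (15.2)] -/
private theorem vcoef_eq_zero {b : ℕ} (hb : max (P2 D) (P3 D) ≤ b) :
    conj iota3 * vk3 D b + conj iota4 * vk2 D b = 0 := by
  rw [vk3_eq_zero (le_trans (le_max_right _ _) hb), vk2_eq_zero (le_trans (le_max_left _ _) hb)]
  simp

/-- `P^{1/2}·max(P₂,P₃) ≤ PT⁻²` once `𝓛 ≥ 3` (`P^{1/2}P₂ = PT⁻¹⁰`; `P^{1/2}P₃ = P^{0.998} ≤ PT⁻²`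
iff `2𝓛^{1.1} ≤ 0.002𝓛⁹`). [cite: Zhang2022LandauSiegel, §15 (15.2)] -/
theorem sqrtP_mul_max_P2_P3_le (hD : 3 ≤ ell D) :
    bigP D ^ (1 / 2 : ℝ) * max (P2 D) (P3 D) ≤ bigP D / bigT D ^ 2 := by
  have hℓ0 : 0 < ell D := by linarith
  have hP : 0 < bigP D := Real.exp_pos _
  have hT1 : 1 ≤ bigT D := Real.one_le_exp (by positivity)
  have hT0 : 0 < bigT D := by linarith
  have hsqrt : bigP D ^ (1 / 2 : ℝ) * bigP D ^ (1 / 2 : ℝ) = bigP D := by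
    rw [← Real.rpow_add hP]; norm_num
  rcases le_total (P3 D) (P2 D) with h32 | h23
  · rw [max_eq_left h32, P2, show (0.5 : ℝ) = 1 / 2 by norm_num, mul_div_assoc', hsqrt]
    exact div_le_div_of_nonneg_left hP.le (pow_pos hT0 2) (pow_le_pow_right₀ hT1 (by norm_num))
  · rw [max_eq_right h23, P3, ← Real.rpow_add hP]
    -- `P^{0.998} ≤ P T⁻²`, i.e. `T² ≤ P^{0.002}`
    rw [le_div_iff₀ (pow_pos hT0 2)]
    have hT2 : bigT D ^ 2 = Real.exp (2 * ell D ^ (1.1 : ℝ)) := by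
      rw [bigT, ← Real.exp_nat_mul]; norm_num
    -- `2 𝓛^{1.1} ≤ 0.002 𝓛⁹`: `𝓛^{1.1} ≤ 𝓛²` and `1000 𝓛² ≤ 𝓛⁹` for `𝓛 ≥ 3`
    have h1 : ell D ^ (1.1 : ℝ) ≤ ell D ^ 2 := by
      have := Real.rpow_le_rpow_of_exponent_le (x := ell D) (by linarith) (show (1.1 : ℝ) ≤ 2 by norm_num)
      rwa [Real.rpow_two] at this
    have h3 : 1000 * ell D ^ 2 ≤ ell D ^ 9 := by
      have h27 : (27 : ℝ) ≤ ell D ^ 3 := by nlinarith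
      have : ell D ^ 9 = ell D ^ 2 * (ell D ^ 3 * ell D ^ 3 * ell D) := by ring
      rw [this]
      have : (1000 : ℝ) ≤ ell D ^ 3 * ell D ^ 3 * ell D := by nlinarith
      nlinarith
    have key : bigT D ^ 2 ≤ bigP D ^ (0.002 : ℝ) := by
      rw [hT2, bigP, ← Real.exp_mul, Real.exp_le_exp]
      linarith
    calc bigP D ^ (1 / 2 + 0.498 : ℝ) * bigT D ^ 2
        ≤ bigP D ^ (1 / 2 + 0.498 : ℝ) * bigP D ^ (0.002 : ℝ) :=
          mul_le_mul_of_nonneg_left key (by positivity)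
      _ = bigP D := by rw [← Real.rpow_add hP]; norm_num

/-- **(15.2), second assertion (support): `b(n) = 0` for `n ≥ PT⁻²`** (`𝓛 ≥ 3`), hence a fortiori
for `n > PT⁻²η₊` as printed. [cite: Zhang2022LandauSiegel, §15 (15.2) p. 79] -/
theorem bcoef_eq_zero_of_le (hD : 3 ≤ ell D) {n : ℕ} (hn : bigP D / bigT D ^ 2 ≤ n) :
    bcoef D n = 0 := by
  rw [bcoef]
  refine Finset.sum_eq_zero fun q hq => ?_
  by_contra hne
  have hu := left_ne_zero_of_mul hne
  have hv := right_ne_zero_of_mul hne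
  have ha : (q.1 : ℝ) < bigP D ^ (1 / 2 : ℝ) := by
    by_contra h; rw [not_lt] at h; exact hu (ucoef_eq_zero h)
  have hb : (q.2 : ℝ) < max (P2 D) (P3 D) := by
    by_contra h; rw [not_lt] at h; exact hv (vcoef_eq_zero h)
  have hqn : (q.1 : ℝ) * q.2 = n := by
    have := (Nat.mem_divisorsAntidiagonal.mp hq).1
    exact_mod_cast this
  have h0a : (0 : ℝ) ≤ q.1 := Nat.cast_nonneg _
  have h0b : (0 : ℝ) ≤ q.2 := Nat.cast_nonneg _
  have hlt : (n : ℝ) < bigP D ^ (1 / 2 : ℝ) * max (P2 D) (P3 D) := by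
    rw [← hqn]
    exact mul_lt_mul'' ha hb h0a h0b
  linarith [sqrtP_mul_max_P2_P3_le hD]

/-- `η₊ = exp(𝓛⁻¹⁰) ≥ 1`. [cite: Zhang2022LandauSiegel, §10 p. 53] -/
theorem one_le_etaPM_one (D : ℕ) : 1 ≤ etaPM D 1 := by
  rw [etaPM, one_mul]
  exact Real.one_le_exp (inv_nonneg.mpr (pow_nonneg (Real.log_natCast_nonneg D) _))

/-- **(15.2) in the exact shape typed by L4-t1** (`Typed.Section15A.Eq15_2`, with `C =
(1+|ι₂|)(|ι₃|+|ι₄|)`): for all large `D` (every real primitive `χ`), `|b(n)| ≤ Cτ₂(n)` for all `n`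
and `b(n) = 0` whenever `n > PT⁻²η₊`. [cite: Zhang2022LandauSiegel, §15 (15.2) p. 79] -/
theorem eq15_2_statement :
    ∃ C : ℝ, ForAllLarge fun D _ _ =>
      (∀ n : ℕ, ‖bcoef D n‖ ≤ C * MeanSquareMajorant.tau 2 n) ∧
      ∀ n : ℕ, bigP D / bigT D ^ 2 * etaPM D 1 < n → bcoef D n = 0 := by
  refine ⟨(1 + ‖iota2‖) * (‖iota3‖ + ‖iota4‖), ⌈Real.exp 3⌉₊, fun D _ χ hD _ _ => ?_⟩
  have hlog : 3 ≤ Real.log D := by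
    have h : Real.exp 3 ≤ D := le_trans (Nat.le_ceil _) (by exact_mod_cast hD)
    exact (Real.le_log_iff_exp_le (lt_of_lt_of_le (Real.exp_pos _) h)).mpr h
  refine ⟨fun n => norm_bcoef_le (by linarith) n, fun n hn => bcoef_eq_zero_of_le hlog ?_⟩
  have hPT : 0 ≤ bigP D / bigT D ^ 2 := by rw [bigP, bigT]; positivity
  nlinarith [one_le_etaPM_one D]

/-! ### (15.1): `B(s,ψ) = Σ_n b(n)χψ(n)n^{−s}` -/

/-- `ψχ(0) = 0`. [folklore] -/
private theorem pc_zero' : pc χ x 0 = 0 := by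
  haveI : Fact (1 < x.p) := ⟨x.prime.one_lt⟩
  rw [pc, Nat.cast_zero, Nat.cast_zero, MulChar.map_zero, zero_mul]

/-- `ψχ` is completely multiplicative. [folklore] -/
private theorem pc_mul (a b : ℕ) : pc χ x (a * b) = pc χ x a * pc χ x b := by
  rw [pc, pc, pc, Nat.cast_mul, Nat.cast_mul, map_mul, map_mul]
  ring

/-- The term of a `ψχ`-twisted series: `term (f·ψχ) s n = f(n)ψχ(n)n^{−s}` (also at `n = 0`, both `0`).
[cite: Zhang2022LandauSiegel, §15 (15.1)] -/
private theorem term_tw (f : ℕ → ℂ) (s : ℂ) (n : ℕ) :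
    LSeries.term (fun m => f m * pc χ x m) s n = f n * pc χ x n * (n : ℂ) ^ (-s) := by
  rcases eq_or_ne n 0 with rfl | hn
  · rw [LSeries.term_zero, pc_zero']; simp
  · rw [LSeries.term_of_ne_zero hn, Complex.cpow_neg, div_eq_mul_inv]

/-- A finitely supported twisted series is summable and equals the finite sum over any range
containing the support. [cite: Zhang2022LandauSiegel, §15 (15.1)] -/
private theorem LSeries_tw_eq_sum (f : ℕ → ℂ) {N : ℕ} (hf : ∀ n, N ≤ n → f n = 0) (s : ℂ) :
    LSeriesSummable (fun m => f m * pc χ x m) s ∧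
      LSeries (fun m => f m * pc χ x m) s = ∑ n ∈ Finset.range N, f n * pc χ x n * (n : ℂ) ^ (-s) := by
  have hz : ∀ n ∉ Finset.range N, LSeries.term (fun m => f m * pc χ x m) s n = 0 := by
    intro n hn
    rw [Finset.mem_range, not_lt] at hn
    rw [term_tw, hf n hn]; simp
  refine ⟨summable_of_ne_finset_zero hz, ?_⟩
  rw [LSeries, tsum_eq_sum hz]
  exact Finset.sum_congr rfl fun n _ => term_tw χ x f s n

/-- Re-indexing: a sum `Σ_{1 ≤ n < ⌈Q⌉} v(n)ψχ(n)n^{−s}` with `v = 0` from `Q` on is the sum over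
`0 ≤ n < ⌈P₁⌉` when `Q ≤ P₁`. [cite: Zhang2022LandauSiegel, §2 (2.23)–(2.25)] -/
private theorem sum_Ico_eq_sum_range' {Q : ℝ} (hQ : Q ≤ P1 D) (v : ℕ → ℂ)
    (hv : ∀ n : ℕ, Q ≤ n → v n = 0) (s : ℂ) :
    ∑ n ∈ Finset.Ico 1 ⌈Q⌉₊, v n * pc χ x n * (n : ℂ) ^ (-s) =
      ∑ n ∈ Finset.range ⌈P1 D⌉₊, v n * pc χ x n * (n : ℂ) ^ (-s) := by
  apply Finset.sum_subset
  · intro n hn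
    rw [Finset.mem_Ico] at hn
    exact Finset.mem_range.mpr (lt_of_lt_of_le hn.2 (Nat.ceil_mono hQ))
  · intro n _ hn'
    rw [Finset.mem_Ico, not_and_or, not_le, not_lt] at hn'
    rcases hn' with h0 | hP
    · have : n = 0 := by omega
      rw [this, pc_zero']; simp
    · rw [hv n (le_trans (Nat.le_ceil _) (by exact_mod_cast hP))]; simp

/-- `H₁₄ = Σ_{n<⌈P₁⌉} ϰ₁(n)[n < P^{1/2}]ψχ(n)n^{−s}`. [cite: Zhang2022LandauSiegel, §12 (12.1)] -/
private theorem H14_eq_sum (s : ℂ) :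
    H14 χ x s = ∑ n ∈ Finset.range ⌈P1 D⌉₊,
      (if (n : ℝ) < bigP D ^ (1 / 2 : ℝ) then vk1 D n else 0) * pc χ x n * (n : ℂ) ^ (-s) := by
  rw [H14]
  calc ∑ n ∈ (Finset.Ico 1 ⌈P1 D⌉₊).filter (fun n : ℕ => (n : ℝ) < bigP D ^ (1 / 2 : ℝ)),
        vk1 D n * pc χ x n * (n : ℂ) ^ (-s)
      = ∑ n ∈ (Finset.Ico 1 ⌈P1 D⌉₊).filter (fun n : ℕ => (n : ℝ) < bigP D ^ (1 / 2 : ℝ)),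
        (if (n : ℝ) < bigP D ^ (1 / 2 : ℝ) then vk1 D n else 0) * pc χ x n * (n : ℂ) ^ (-s) :=
        Finset.sum_congr rfl fun n hn => by rw [if_pos (Finset.mem_filter.mp hn).2]
    _ = ∑ n ∈ Finset.range ⌈P1 D⌉₊,
        (if (n : ℝ) < bigP D ^ (1 / 2 : ℝ) then vk1 D n else 0) * pc χ x n * (n : ℂ) ^ (-s) := by
        apply Finset.sum_subset
        · intro n hn
          exact Finset.mem_range.mpr (Finset.mem_Ico.mp (Finset.mem_filter.mp hn).1).2
        · intro n hn hn'
          rw [Finset.mem_filter, not_and, Finset.mem_Ico, not_lt] at hn'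
          rcases Nat.eq_zero_or_pos n with rfl | hpos
          · rw [pc_zero']; simp
          · rw [if_neg (not_lt.mpr (hn' ⟨hpos, Finset.mem_range.mp hn⟩))]; simp

/-- `H₁₄ + ι₂H₁₂ = Σ_{n<⌈P₁⌉} u(n)ψχ(n)n^{−s}`. [cite: Zhang2022LandauSiegel, §12 (12.1)–(12.2)] -/
private theorem H14_add_eq_sum (s : ℂ) :
    H14 χ x s + iota2 * H12 χ x s =
      ∑ n ∈ Finset.range ⌈P1 D⌉₊,
        ((if (n : ℝ) < bigP D ^ (1 / 2 : ℝ) then vk1 D n else 0) + iota2 * vk2 D n) *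
          pc χ x n * (n : ℂ) ^ (-s) := by
  rw [H14_eq_sum, H12, sum_Ico_eq_sum_range' χ x (P2_le_P1 D) (vk2 D) (fun n hn => vk2_eq_zero hn) s,
    Finset.mul_sum, ← Finset.sum_add_distrib]
  refine Finset.sum_congr rfl fun n _ => ?_
  ring

/-- `H₂ = ῑ₃H₁₃ + ῑ₄H₁₂ = Σ_{n<⌈P₁⌉} v(n)ψχ(n)n^{−s}`. [cite: Zhang2022LandauSiegel, §2 (2.27)] -/
private theorem H2_eq_sum (s : ℂ) :
    H2 χ x s = ∑ n ∈ Finset.range ⌈P1 D⌉₊,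
      (conj iota3 * vk3 D n + conj iota4 * vk2 D n) * pc χ x n * (n : ℂ) ^ (-s) := by
  rw [H2, H13, H12, sum_Ico_eq_sum_range' χ x (P3_le_P1 D) (vk3 D) (fun n hn => vk3_eq_zero hn) s,
    sum_Ico_eq_sum_range' χ x (P2_le_P1 D) (vk2 D) (fun n hn => vk2_eq_zero hn) s,
    Finset.mul_sum, Finset.mul_sum, ← Finset.sum_add_distrib]
  refine Finset.sum_congr rfl fun n _ => ?_
  ring

/-- The twisted convolution: `(u·ψχ) ⍟ (v·ψχ) = (u ⍟ v)·ψχ` (`ψχ` completely multiplicative).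
[cite: Zhang2022LandauSiegel, §15 (15.1)] -/
private theorem tw_convolution (u v : ℕ → ℂ) (n : ℕ) :
    ((fun m => u m * pc χ x m) ⍟ (fun m => v m * pc χ x m)) n = (u ⍟ v) n * pc χ x n := by
  rw [LSeries.convolution_def, LSeries.convolution_def, Finset.sum_mul]
  refine Finset.sum_congr rfl fun q hq => ?_
  have hqn : q.1 * q.2 = n := (Nat.mem_divisorsAntidiagonal.mp hq).1
  rw [← hqn, pc_mul]
  ring

/-- **(15.1): `B(s,ψ) = Σ_n b(n)χψ(n)n^{−s}`** (DAG `Z22:(15.1)`; the exact statement L4-t1 typed as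
`Typed.Section15A.Eq15_1`, for every `D`, `ψ ∈ Ψ`, `s`): the banked `B = (H₁₄ + ι₂H₁₂)(ῑ₃H₁₃ + ῑ₄H₁₂)`
(12.2) is the Dirichlet series with coefficients `b(n)χψ(n)`, `b` the banked `ϰ`-convolution `bcoef`.
[cite: Zhang2022LandauSiegel, §15 (15.1) p. 79] -/
theorem Bpoly_eq_tsum_bcoef (s : ℂ) :
    Bpoly χ x s = ∑' n : ℕ, bcoef D n * pc χ x n * (n : ℂ) ^ (-s) := by
  have hu0 : ∀ n, ⌈P1 D⌉₊ ≤ n →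
      (if (n : ℝ) < bigP D ^ (1 / 2 : ℝ) then vk1 D n else 0) + iota2 * vk2 D n = 0 := fun n hn =>
    ucoef_eq_zero (le_trans sqrtP_le_P1 (le_trans (Nat.le_ceil _) (by exact_mod_cast hn)))
  have hv0 : ∀ n, ⌈P1 D⌉₊ ≤ n → conj iota3 * vk3 D n + conj iota4 * vk2 D n = 0 := fun n hn => by
    have hP1 : P1 D ≤ n := le_trans (Nat.le_ceil _) (by exact_mod_cast hn)
    rw [vk3_eq_zero (le_trans (P3_le_P1 D) hP1), vk2_eq_zero (le_trans (P2_le_P1 D) hP1)]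
    simp
  have hu := LSeries_tw_eq_sum χ x _ hu0 s
  have hv := LSeries_tw_eq_sum χ x _ hv0 s
  set U : ℕ → ℂ := fun n => (if (n : ℝ) < bigP D ^ (1 / 2 : ℝ) then vk1 D n else 0) + iota2 * vk2 D n
  set V : ℕ → ℂ := fun n => conj iota3 * vk3 D n + conj iota4 * vk2 D n
  have hconv : LSeries ((fun m => U m * pc χ x m) ⍟ (fun m => V m * pc χ x m)) s =
      LSeries (fun m => bcoef D m * pc χ x m) s := by
    rw [LSeries, LSeries]
    refine tsum_congr fun n => ?_
    rw [LSeries.term_def, LSeries.term_def, tw_convolution, bcoef_eq_convolution]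
  calc Bpoly χ x s = (H14 χ x s + iota2 * H12 χ x s) * H2 χ x s := by rw [Bpoly]
    _ = LSeries (fun m => U m * pc χ x m) s * LSeries (fun m => V m * pc χ x m) s := by
        rw [H14_add_eq_sum, H2_eq_sum, hu.2, hv.2]
    _ = LSeries ((fun m => U m * pc χ x m) ⍟ (fun m => V m * pc χ x m)) s :=
        (LSeries_convolution' hu.1 hv.1).symm
    _ = LSeries (fun m => bcoef D m * pc χ x m) s := hconv
    _ = ∑' n : ℕ, bcoef D n * pc χ x n * (n : ℂ) ^ (-s) := by
        rw [LSeries]; exact tsum_congr fun n => term_tw χ x (bcoef D) s n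

/-- **(15.1), finite form**: `B(s,ψ) = Σ_{n<N} b(n)χψ(n)n^{−s}` for any `N ≥ PT⁻²` (`𝓛 ≥ 3`) — by the
support bound of (15.2). [cite: Zhang2022LandauSiegel, §15 (15.1)–(15.2) p. 79] -/
theorem Bpoly_eq_sum_bcoef (hD : 3 ≤ ell D) {N : ℕ} (hN : bigP D / bigT D ^ 2 ≤ N) (s : ℂ) :
    Bpoly χ x s = ∑ n ∈ Finset.range N, bcoef D n * pc χ x n * (n : ℂ) ^ (-s) := by
  rw [Bpoly_eq_tsum_bcoef]
  refine tsum_eq_sum fun n hn => ?_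
  rw [Finset.mem_range, not_lt] at hn
  rw [bcoef_eq_zero_of_le hD (le_trans hN (by exact_mod_cast hn))]
  simp

end Coefficients

end Literature.NumberTheory.LFunctions.Zhang2022.Skeleton
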